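import Summits.Ventures.PercRepro.LemmaBTwoTypes

/-!
# Lemma B on a sub-cube from a separating two-colouring of its crossing points

Call `σ` a **crossing point** of the sub-cube `(S, ω₀)` when its configuration `patch S σ ω₀` lies
in one crossing cell `x_i` and the configuration of its antipode `flipOn S σ` lies in a different
crossing cell `x_j`. A two-colouring `χ` of the `σ`'s is **separating** when

* any two crossing points of different colours have their join in `top` and their meet in `bot`
  (as sub-cube points, i.e. after `patch`), and
* every crossing point and its antipode have different colours.

Then **Lemma B holds on the sub-cube** (`lemmaB_subcube_of_separating_colouring`): Daykin's
inequality (`card_pairSet_le_of_complementary`) applied to the two colour classes bounds the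
antipodal `(colour 0, colour 1)` pairs by the `(top, bot)` pairs, and every crossing pair is such a
pair (or its reverse).

The three two-type theorems of `LemmaBTwoTypes` are the special cases `χ σ := [patch S σ ω₀ ∈ x_i]`
(colour `x_i` against the other two crossing cells; `lemmaB_subcube_of_two_types₁₂_of_colouring` below).
More generally, let `M` be the set of sub-cube points whose cell is neither `top` nor `bot`, and
let `H` be the multigraph whose vertices are the connected components of the comparability graph
on `M` and whose edges are the antipodal pairs of `M` lying in different components; two points
of `M` in different components have their join in `top` and their meet in `bot` (the join is above
both, hence not in `bot`; a point of `M` above both would be comparable with both, contradicting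
different components), and crossing points are in `M` with antipodes in other components. Hence
**whenever `H` is bipartite**, the bipartition of the components is a separating colouring and
Lemma B holds on the sub-cube — three crossing types are no obstruction by themselves. (This is
the content of `HOME/proofs/P4-components.md`; `H` is bipartite for every sub-cube of dimension
`≤ 5`, so the genuine content of Lemma B begins in dimension `6`.)
-/

namespace PercRepro

open Finset

/-- Arithmetic core of the crossing-pair count: if `a₁ + a₂ + a₃ ≤ 1` and `b₁ + b₂ + b₃ ≤ 1`
(naturals), the six mixed products sum to at most one. -/
theorem six_mixed_products_le_one (a₁ a₂ a₃ b₁ b₂ b₃ : ℕ) (ha : a₁ + a₂ + a₃ ≤ 1)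
    (hb : b₁ + b₂ + b₃ ≤ 1) :
    a₁ * b₂ + a₂ * b₁ + a₁ * b₃ + a₃ * b₁ + a₂ * b₃ + a₃ * b₂ ≤ 1 := by
  have e : (a₁ + a₂ + a₃) * (b₁ + b₂ + b₃) =
      (a₁ * b₂ + a₂ * b₁ + a₁ * b₃ + a₃ * b₁ + a₂ * b₃ + a₃ * b₂) +
        (a₁ * b₁ + a₂ * b₂ + a₃ * b₃) := by ring
  calc a₁ * b₂ + a₂ * b₁ + a₁ * b₃ + a₃ * b₁ + a₂ * b₃ + a₃ * b₂
      ≤ (a₁ + a₂ + a₃) * (b₁ + b₂ + b₃) := by rw [e]; exact Nat.le_add_right _ _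
    _ ≤ 1 * 1 := Nat.mul_le_mul ha hb
    _ = 1 := by norm_num

/-- An indicator of a conjunction is the product of the indicators. -/
theorem ite_and_one_zero (p q : Prop) [Decidable p] [Decidable q] :
    (if p ∧ q then (1 : ℕ) else 0) = (if p then (1 : ℕ) else 0) * (if q then (1 : ℕ) else 0) := by
  by_cases hp : p <;> by_cases hq : q <;> simp [hp, hq]

variable {E : Type*} [Fintype E] [DecidableEq E]

namespace MultiGraph

variable {V : Type*} (G : MultiGraph V E)

/-! ### The three crossing cells are pairwise disjoint -/

omit [Fintype E] [DecidableEq E] in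
/-- `x₁ = ab|cd` and `x₂ = ac|bd` are disjoint events. -/
theorem not_mem_crossEvent₁_crossEvent₂ {a b c d : V} {ω : Config E}
    (h₁ : ω ∈ G.crossEvent₁ a b c d) (h₂ : ω ∈ G.crossEvent₂ a b c d) : False := by
  rw [mem_crossEvent₁] at h₁
  rw [mem_crossEvent₂] at h₂
  exact h₂.2.2 h₁.1

omit [Fintype E] [DecidableEq E] in
/-- `x₁ = ab|cd` and `x₃ = ad|bc` are disjoint events. -/
theorem not_mem_crossEvent₁_crossEvent₃ {a b c d : V} {ω : Config E}
    (h₁ : ω ∈ G.crossEvent₁ a b c d) (h₃ : ω ∈ G.crossEvent₃ a b c d) : False := by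
  rw [mem_crossEvent₁] at h₁
  rw [mem_crossEvent₃] at h₃
  exact h₃.2.2 h₁.1

omit [Fintype E] [DecidableEq E] in
/-- `x₂ = ac|bd` and `x₃ = ad|bc` are disjoint events (`a ~ c ~ b` would connect `a` and `b`). -/
theorem not_mem_crossEvent₂_crossEvent₃ {a b c d : V} {ω : Config E}
    (h₂ : ω ∈ G.crossEvent₂ a b c d) (h₃ : ω ∈ G.crossEvent₃ a b c d) : False := by
  rw [mem_crossEvent₂] at h₂
  rw [mem_crossEvent₃] at h₃
  exact h₂.2.2 (h₂.1.trans h₃.2.1.symm)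

omit [Fintype E] [DecidableEq E] in
open scoped Classical in
/-- A configuration lies in at most one crossing cell: the three indicators sum to `≤ 1`. -/
theorem crossIndicator_sum_le_one (a b c d : V) (ω : Config E) :
    (if ω ∈ G.crossEvent₁ a b c d then (1 : ℕ) else 0) +
      (if ω ∈ G.crossEvent₂ a b c d then (1 : ℕ) else 0) +
      (if ω ∈ G.crossEvent₃ a b c d then (1 : ℕ) else 0) ≤ 1 := by
  by_cases h₁ : ω ∈ G.crossEvent₁ a b c d
  · have h₂ : ω ∉ G.crossEvent₂ a b c d := fun h => G.not_mem_crossEvent₁_crossEvent₂ h₁ h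
    have h₃ : ω ∉ G.crossEvent₃ a b c d := fun h => G.not_mem_crossEvent₁_crossEvent₃ h₁ h
    simp [h₁, h₂, h₃]
  · by_cases h₂ : ω ∈ G.crossEvent₂ a b c d
    · have h₃ : ω ∉ G.crossEvent₃ a b c d := fun h => G.not_mem_crossEvent₂_crossEvent₃ h₂ h
      simp [h₁, h₂, h₃]
    · by_cases h₃ : ω ∈ G.crossEvent₃ a b c d <;> simp [h₁, h₂, h₃]

/-! ### Crossing points of a sub-cube -/

/-- `σ` is a **crossing point** of the sub-cube `(S, ω₀)`: its configuration and the
configuration of its antipode lie in two different crossing cells. -/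
def IsCrossing (a b c d : V) (S : Finset E) (ω₀ σ : Config E) : Prop :=
  (patch S σ ω₀ ∈ G.crossEvent₁ a b c d ∧ patch S (flipOn S σ) ω₀ ∈ G.crossEvent₂ a b c d) ∨
  (patch S σ ω₀ ∈ G.crossEvent₂ a b c d ∧ patch S (flipOn S σ) ω₀ ∈ G.crossEvent₁ a b c d) ∨
  (patch S σ ω₀ ∈ G.crossEvent₁ a b c d ∧ patch S (flipOn S σ) ω₀ ∈ G.crossEvent₃ a b c d) ∨
  (patch S σ ω₀ ∈ G.crossEvent₃ a b c d ∧ patch S (flipOn S σ) ω₀ ∈ G.crossEvent₁ a b c d) ∨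
  (patch S σ ω₀ ∈ G.crossEvent₂ a b c d ∧ patch S (flipOn S σ) ω₀ ∈ G.crossEvent₃ a b c d) ∨
  (patch S σ ω₀ ∈ G.crossEvent₃ a b c d ∧ patch S (flipOn S σ) ω₀ ∈ G.crossEvent₂ a b c d)

omit [Fintype E] in
/-- The antipode of a crossing point is a crossing point. -/
theorem IsCrossing.flipOn {a b c d : V} {S : Finset E} {ω₀ σ : Config E}
    (h : G.IsCrossing a b c d S ω₀ σ) : G.IsCrossing a b c d S ω₀ (flipOn S σ) := by
  unfold IsCrossing at h ⊢
  rw [MultiGraph.flipOn_flipOn]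
  rcases h with h | h | h | h | h | h
  · exact Or.inr (Or.inl ⟨h.2, h.1⟩)
  · exact Or.inl ⟨h.2, h.1⟩
  · exact Or.inr (Or.inr (Or.inr (Or.inl ⟨h.2, h.1⟩)))
  · exact Or.inr (Or.inr (Or.inl ⟨h.2, h.1⟩))
  · exact Or.inr (Or.inr (Or.inr (Or.inr (Or.inr ⟨h.2, h.1⟩))))
  · exact Or.inr (Or.inr (Or.inr (Or.inr (Or.inl ⟨h.2, h.1⟩))))

omit [Fintype E] in
open scoped Classical in
/-- The six ordered crossing-pair indicators of a sub-cube point sum to at most one. -/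
theorem crossPair_sum_le_one (a b c d : V) (S : Finset E) (ω₀ σ : Config E) :
    (if patch S σ ω₀ ∈ G.crossEvent₁ a b c d ∧ patch S (flipOn S σ) ω₀ ∈ G.crossEvent₂ a b c d
        then (1 : ℕ) else 0) +
      (if patch S σ ω₀ ∈ G.crossEvent₂ a b c d ∧ patch S (flipOn S σ) ω₀ ∈ G.crossEvent₁ a b c d
        then (1 : ℕ) else 0) +
      (if patch S σ ω₀ ∈ G.crossEvent₁ a b c d ∧ patch S (flipOn S σ) ω₀ ∈ G.crossEvent₃ a b c d
        then (1 : ℕ) else 0) +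
      (if patch S σ ω₀ ∈ G.crossEvent₃ a b c d ∧ patch S (flipOn S σ) ω₀ ∈ G.crossEvent₁ a b c d
        then (1 : ℕ) else 0) +
      (if patch S σ ω₀ ∈ G.crossEvent₂ a b c d ∧ patch S (flipOn S σ) ω₀ ∈ G.crossEvent₃ a b c d
        then (1 : ℕ) else 0) +
      (if patch S σ ω₀ ∈ G.crossEvent₃ a b c d ∧ patch S (flipOn S σ) ω₀ ∈ G.crossEvent₂ a b c d
        then (1 : ℕ) else 0) ≤ 1 := by
  simp only [ite_and_one_zero]
  exact six_mixed_products_le_one _ _ _ _ _ _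
    (G.crossIndicator_sum_le_one a b c d (patch S σ ω₀))
    (G.crossIndicator_sum_le_one a b c d (patch S (flipOn S σ) ω₀))

omit [Fintype E] in
open scoped Classical in
/-- If one of the six ordered crossing-pair indicators of `σ` is positive, `σ` is a crossing
point. -/
theorem isCrossing_of_crossPair_sum_pos (a b c d : V) (S : Finset E) (ω₀ σ : Config E)
    (h : 0 <
      (if patch S σ ω₀ ∈ G.crossEvent₁ a b c d ∧ patch S (flipOn S σ) ω₀ ∈ G.crossEvent₂ a b c d
        then (1 : ℕ) else 0) +
      (if patch S σ ω₀ ∈ G.crossEvent₂ a b c d ∧ patch S (flipOn S σ) ω₀ ∈ G.crossEvent₁ a b c d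
        then (1 : ℕ) else 0) +
      (if patch S σ ω₀ ∈ G.crossEvent₁ a b c d ∧ patch S (flipOn S σ) ω₀ ∈ G.crossEvent₃ a b c d
        then (1 : ℕ) else 0) +
      (if patch S σ ω₀ ∈ G.crossEvent₃ a b c d ∧ patch S (flipOn S σ) ω₀ ∈ G.crossEvent₁ a b c d
        then (1 : ℕ) else 0) +
      (if patch S σ ω₀ ∈ G.crossEvent₂ a b c d ∧ patch S (flipOn S σ) ω₀ ∈ G.crossEvent₃ a b c d
        then (1 : ℕ) else 0) +
      (if patch S σ ω₀ ∈ G.crossEvent₃ a b c d ∧ patch S (flipOn S σ) ω₀ ∈ G.crossEvent₂ a b c d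
        then (1 : ℕ) else 0)) :
    G.IsCrossing a b c d S ω₀ σ := by
  by_contra hne
  unfold IsCrossing at hne
  simp only [not_or] at hne
  obtain ⟨n1, n2, n3, n4, n5, n6⟩ := hne
  simp only [if_neg n1, if_neg n2, if_neg n3, if_neg n4, if_neg n5, if_neg n6, add_zero,
    lt_self_iff_false] at h

/-! ### The theorem -/

/-- **Lemma B on a sub-cube from a separating two-colouring.** If `χ` colours the sub-cube points
so that (i) crossing points of different colours have their join in `top` and their meet in `bot`
and (ii) every crossing point has a colour different from its antipode's, then the sub-cube sum
of the C-005 kernel is nonnegative. (Bipartite component graph ⇒ Lemma B; the two-type theorems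
are the special cases `χ = [· ∈ x_i]`.) -/
theorem lemmaB_subcube_of_separating_colouring (a b c d : V) (S : Finset E) (ω₀ : Config E)
    (χ : Config E → Bool)
    (hsep : ∀ σ τ : Config E, G.IsCrossing a b c d S ω₀ σ → G.IsCrossing a b c d S ω₀ τ →
      χ σ ≠ χ τ →
      patch S (σ ⊔ τ) ω₀ ∈ G.topEvent a b c d ∧ patch S (σ ⊓ τ) ω₀ ∈ G.botEvent a b c d)
    (hcross : ∀ σ : Config E, G.IsCrossing a b c d S ω₀ σ → χ σ ≠ χ (flipOn S σ)) :
    0 ≤ ∑ σ : Config E, G.c005Kernel a b c d (patch S σ ω₀) (patch S (flipOn S σ) ω₀) := by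
  classical
  -- the two colour classes, as sets of configurations
  obtain ⟨X, hX⟩ : ∃ X : Set (Config E),
      X = {ω | ∃ σ, ω = patch S σ ω₀ ∧ G.IsCrossing a b c d S ω₀ σ ∧ χ σ = false} := ⟨_, rfl⟩
  obtain ⟨Y, hY⟩ : ∃ Y : Set (Config E),
      Y = {ω | ∃ σ, ω = patch S σ ω₀ ∧ G.IsCrossing a b c d S ω₀ σ ∧ χ σ = true} := ⟨_, rfl⟩
  have hsup : ∀ ω ω', ω ∈ X → ω' ∈ Y → ω ⊔ ω' ∈ G.topEvent a b c d := by
    intro ω ω' hω hω'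
    rw [hX] at hω
    rw [hY] at hω'
    obtain ⟨σ, rfl, hσ, hχσ⟩ := hω
    obtain ⟨τ, rfl, hτ, hχτ⟩ := hω'
    rw [← patch_sup]
    exact (hsep σ τ hσ hτ (by rw [hχσ, hχτ]; decide)).1
  have hinf : ∀ ω ω', ω ∈ X → ω' ∈ Y → ω ⊓ ω' ∈ G.botEvent a b c d := by
    intro ω ω' hω hω'
    rw [hX] at hω
    rw [hY] at hω'
    obtain ⟨σ, rfl, hσ, hχσ⟩ := hω
    obtain ⟨τ, rfl, hτ, hχτ⟩ := hω'
    rw [← patch_inf]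
    exact (hsep σ τ hσ hτ (by rw [hχσ, hχτ]; decide)).2
  -- Daykin: (X, Y) antipodal pairs ≤ (top, bot) antipodal pairs
  have hle := G.card_pairSet_le_of_complementary S ω₀ (a := a) (b := b) (c := c) (d := d)
    (X := X) (Y := Y) hsup hinf
  -- pointwise: the six crossing indicators of σ are dominated by the (X,Y) + (Y,X) indicators
  have hpt : ∀ σ : Config E,
      (if patch S σ ω₀ ∈ G.crossEvent₁ a b c d ∧ patch S (flipOn S σ) ω₀ ∈ G.crossEvent₂ a b c d
        then (1 : ℕ) else 0) +
      (if patch S σ ω₀ ∈ G.crossEvent₂ a b c d ∧ patch S (flipOn S σ) ω₀ ∈ G.crossEvent₁ a b c d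
        then (1 : ℕ) else 0) +
      (if patch S σ ω₀ ∈ G.crossEvent₁ a b c d ∧ patch S (flipOn S σ) ω₀ ∈ G.crossEvent₃ a b c d
        then (1 : ℕ) else 0) +
      (if patch S σ ω₀ ∈ G.crossEvent₃ a b c d ∧ patch S (flipOn S σ) ω₀ ∈ G.crossEvent₁ a b c d
        then (1 : ℕ) else 0) +
      (if patch S σ ω₀ ∈ G.crossEvent₂ a b c d ∧ patch S (flipOn S σ) ω₀ ∈ G.crossEvent₃ a b c d
        then (1 : ℕ) else 0) +
      (if patch S σ ω₀ ∈ G.crossEvent₃ a b c d ∧ patch S (flipOn S σ) ω₀ ∈ G.crossEvent₂ a b c d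
        then (1 : ℕ) else 0) ≤
      (if patch S σ ω₀ ∈ X ∧ patch S (flipOn S σ) ω₀ ∈ Y then (1 : ℕ) else 0) +
      (if patch S σ ω₀ ∈ Y ∧ patch S (flipOn S σ) ω₀ ∈ X then (1 : ℕ) else 0) := by
    intro σ
    rcases Nat.eq_zero_or_pos
      ((if patch S σ ω₀ ∈ G.crossEvent₁ a b c d ∧ patch S (flipOn S σ) ω₀ ∈ G.crossEvent₂ a b c d
        then (1 : ℕ) else 0) +
      (if patch S σ ω₀ ∈ G.crossEvent₂ a b c d ∧ patch S (flipOn S σ) ω₀ ∈ G.crossEvent₁ a b c d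
        then (1 : ℕ) else 0) +
      (if patch S σ ω₀ ∈ G.crossEvent₁ a b c d ∧ patch S (flipOn S σ) ω₀ ∈ G.crossEvent₃ a b c d
        then (1 : ℕ) else 0) +
      (if patch S σ ω₀ ∈ G.crossEvent₃ a b c d ∧ patch S (flipOn S σ) ω₀ ∈ G.crossEvent₁ a b c d
        then (1 : ℕ) else 0) +
      (if patch S σ ω₀ ∈ G.crossEvent₂ a b c d ∧ patch S (flipOn S σ) ω₀ ∈ G.crossEvent₃ a b c d
        then (1 : ℕ) else 0) +
      (if patch S σ ω₀ ∈ G.crossEvent₃ a b c d ∧ patch S (flipOn S σ) ω₀ ∈ G.crossEvent₂ a b c d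
        then (1 : ℕ) else 0)) with h0 | hpos
    · rw [h0]; exact Nat.zero_le _
    · have hσ : G.IsCrossing a b c d S ω₀ σ :=
        G.isCrossing_of_crossPair_sum_pos a b c d S ω₀ σ hpos
      have hσ' : G.IsCrossing a b c d S ω₀ (flipOn S σ) := hσ.flipOn
      have hne := hcross σ hσ
      refine (G.crossPair_sum_le_one a b c d S ω₀ σ).trans ?_
      cases hχ : χ σ
      · -- σ has colour `false`, its antipode colour `true`: σ is an (X, Y) pair
        have hχ' : χ (flipOn S σ) = true := by
          cases h' : χ (flipOn S σ)
          · exact absurd (hχ.trans h'.symm) hne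
          · rfl
        have hmem : patch S σ ω₀ ∈ X ∧ patch S (flipOn S σ) ω₀ ∈ Y := by
          rw [hX, hY]
          exact ⟨⟨σ, rfl, hσ, hχ⟩, ⟨flipOn S σ, rfl, hσ', hχ'⟩⟩
        rw [if_pos hmem]
        exact Nat.le_add_right 1 _
      · have hχ' : χ (flipOn S σ) = false := by
          cases h' : χ (flipOn S σ)
          · rfl
          · exact absurd (hχ.trans h'.symm) hne
        have hmem : patch S σ ω₀ ∈ Y ∧ patch S (flipOn S σ) ω₀ ∈ X := by
          rw [hX, hY]
          exact ⟨⟨σ, rfl, hσ, hχ⟩, ⟨flipOn S σ, rfl, hσ', hχ'⟩⟩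
        rw [if_pos hmem]
        exact Nat.le_add_left 1 _
  -- sum the pointwise bound over the sub-cube
  have hsum := Finset.sum_le_sum (s := (univ : Finset (Config E))) (fun σ _ => hpt σ)
  simp only [Finset.sum_add_distrib] at hsum
  -- express the sums as cardinalities of the `pairSet`s
  have hc : ∀ (A B : Set (Config E)),
      ∑ σ : Config E, (if patch S σ ω₀ ∈ A ∧ patch S (flipOn S σ) ω₀ ∈ B then (1 : ℕ) else 0) =
        (pairSet S ω₀ A B).card := by
    intro A B
    rw [pairSet, Finset.card_filter]
  simp only [hc] at hsum
  have hXY := card_pairSet_comm S ω₀ X Y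
  have hbt := card_pairSet_comm S ω₀ (G.topEvent a b c d) (G.botEvent a b c d)
  rw [G.antipodalSum_c005Kernel']
  have h1 : ((pairSet S ω₀ (G.crossEvent₁ a b c d) (G.crossEvent₂ a b c d)).card : ℝ) +
      ((pairSet S ω₀ (G.crossEvent₂ a b c d) (G.crossEvent₁ a b c d)).card : ℝ) +
      ((pairSet S ω₀ (G.crossEvent₁ a b c d) (G.crossEvent₃ a b c d)).card : ℝ) +
      ((pairSet S ω₀ (G.crossEvent₃ a b c d) (G.crossEvent₁ a b c d)).card : ℝ) +
      ((pairSet S ω₀ (G.crossEvent₂ a b c d) (G.crossEvent₃ a b c d)).card : ℝ) +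
      ((pairSet S ω₀ (G.crossEvent₃ a b c d) (G.crossEvent₂ a b c d)).card : ℝ) ≤
      ((pairSet S ω₀ X Y).card : ℝ) + ((pairSet S ω₀ Y X).card : ℝ) := by
    exact_mod_cast hsum
  have h2 : ((pairSet S ω₀ X Y).card : ℝ) ≤
      ((pairSet S ω₀ (G.topEvent a b c d) (G.botEvent a b c d)).card : ℝ) := by
    exact_mod_cast hle
  have h3 : ((pairSet S ω₀ Y X).card : ℝ) = ((pairSet S ω₀ X Y).card : ℝ) := by
    exact_mod_cast hXY.symm
  have h4 : ((pairSet S ω₀ (G.botEvent a b c d) (G.topEvent a b c d)).card : ℝ) =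
      ((pairSet S ω₀ (G.topEvent a b c d) (G.botEvent a b c d)).card : ℝ) := by
    exact_mod_cast hbt.symm
  linarith

/-- The two-type theorem `lemmaB_subcube_of_two_types₁₂` as a corollary of the separating-colouring
theorem: colour by membership in `x₁`. -/
theorem lemmaB_subcube_of_two_types₁₂_of_colouring (a b c d : V) (S : Finset E) (ω₀ : Config E)
    (h3 : ∀ σ : Config E, patch S σ ω₀ ∈ G.crossEvent₃ a b c d →
      patch S (flipOn S σ) ω₀ ∉ G.crossEvent₁ a b c d ∧
        patch S (flipOn S σ) ω₀ ∉ G.crossEvent₂ a b c d) :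
    0 ≤ ∑ σ : Config E, G.c005Kernel a b c d (patch S σ ω₀) (patch S (flipOn S σ) ω₀) := by
  classical
  refine G.lemmaB_subcube_of_separating_colouring a b c d S ω₀
    (fun σ => decide (patch S σ ω₀ ∈ G.crossEvent₁ a b c d)) ?_ ?_
  · intro σ τ hσ hτ hne
    -- different colours: one of σ, τ is in x₁ and the other in x₂ or x₃
    have key : ∀ σ τ : Config E, G.IsCrossing a b c d S ω₀ τ →
        patch S σ ω₀ ∈ G.crossEvent₁ a b c d → patch S τ ω₀ ∉ G.crossEvent₁ a b c d →
        patch S (σ ⊔ τ) ω₀ ∈ G.topEvent a b c d ∧ patch S (σ ⊓ τ) ω₀ ∈ G.botEvent a b c d := by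
      intro σ τ hτ h1 h1'
      rw [patch_sup, patch_inf]
      unfold IsCrossing at hτ
      rcases hτ with h | h | h | h | h | h
      · exact absurd h.1 h1'
      · exact ⟨sup_mem_topEvent₁₂ h1 h.1, inf_mem_botEvent₁₂ h1 h.1⟩
      · exact absurd h.1 h1'
      · exact ⟨sup_mem_topEvent₁₃ h1 h.1, inf_mem_botEvent₁₃ h1 h.1⟩
      · exact ⟨sup_mem_topEvent₁₂ h1 h.1, inf_mem_botEvent₁₂ h1 h.1⟩
      · exact ⟨sup_mem_topEvent₁₃ h1 h.1, inf_mem_botEvent₁₃ h1 h.1⟩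
    by_cases h1 : patch S σ ω₀ ∈ G.crossEvent₁ a b c d
    · have h1' : patch S τ ω₀ ∉ G.crossEvent₁ a b c d := by
        intro h
        apply hne
        simp [h1, h]
      exact key σ τ hτ h1 h1'
    · have h1' : patch S τ ω₀ ∈ G.crossEvent₁ a b c d := by
        by_contra h
        apply hne
        simp [h1, h]
      have := key τ σ hσ h1' h1
      rw [sup_comm σ τ, inf_comm σ τ]
      exact this
  · intro σ hσ
    unfold IsCrossing at hσ
    rcases hσ with h | h | h | h | h | h
    · have hq : patch S (flipOn S σ) ω₀ ∉ G.crossEvent₁ a b c d :=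
        fun h' => G.not_mem_crossEvent₁_crossEvent₂ h' h.2
      simp [h.1, hq]
    · have hp : patch S σ ω₀ ∉ G.crossEvent₁ a b c d :=
        fun h' => G.not_mem_crossEvent₁_crossEvent₂ h' h.1
      simp [hp, h.2]
    · have := (h3 (flipOn S σ) h.2).1
      rw [flipOn_flipOn] at this
      exact absurd h.1 this
    · exact absurd h.2 (h3 σ h.1).1
    · have := (h3 (flipOn S σ) h.2).2
      rw [flipOn_flipOn] at this
      exact absurd h.1 this
    · exact absurd h.2 (h3 σ h.1).2

end MultiGraph

end PercRepro
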